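import Summits.KontsevichZagierPeriods.KontsevichZagierPeriods.Theses.HurwitzMicroSectors
import Summits.KontsevichZagierPeriods.KontsevichZagierPeriods.Theorems.HurwitzMicroSectorsNormalFormPrinciplePiBoxTransfer
import Summits.KontsevichZagierPeriods.KontsevichZagierPeriods.Theorems.HurwitzMicroSectorsNormalFormPrincipleVariants2238

/-! TTRL-lite variant V2232 of stmt-KontsevichZagierPeriods-3869

Variant V2232 = `stub_boxRigidity` (the leaf `BoxRigidity` of `NormalFormPrinciple`: two representations
on open unit boxes with integrands of KZ's rational shape `p/q`, `p, q` over `ℚ`, and equal values are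
KZ-equivalent) under the TWO-sided small-case move `fix_nat:m=2; fix_nat:m'=8` (left dimension frozen
to `2`, right dimension frozen to `8`). Verdict of the attempt seat: **open** — this file is the
exact-strength certificate, not a proof of the variant. As for every two-sided sibling
(`…Variants2204/2228/2238/…`), the strength of a joint freezing is that of its LARGEST dimension, here `8`:
* `stub_boxRigidity_var2232_iff_boxVanishing_eight`: V2232 ⟺ **BoxVanishing 8** — every box-rational
  representation on `(0,1)⁸` of value `0` is a relation (⇒: compare with the zero representation on
  the square, `boxVanishingDim_right_of_pair 2 8`; ⇐: pad both sides to the `8`-box and subtract there,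
  `boxRigidityLe_of_boxVanishingDim 8`, both tree, `…Variants2238`);
* `stub_boxRigidity_var2232_iff_le_eight`: V2232 ⟺ BoxRigidity with BOTH dimensions `≤ 8` (freezing
  `m = 2`, `m' = 8` rather than bounding them loses nothing);
* `boxVanishing_le_eight_of_stub_boxRigidity_var2232`: V2232 contains BoxVanishing `j` for every
  `j ≤ 8`, hence the siblings V2228 (= BoxVanishing 6), V2238 (= BoxVanishing 3) and V2204
  (= BoxVanishing 2: Conjecture 1 on the level-`4` (Catalan) sector of the square with NO independence
  input — a rung the route closes only under the open hypothesis `Indep_ℚ(1, π², G)`); BoxVanishing 8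
  moreover decides every `ℚ`-linear relation among the absolutely convergent `∫_{(0,1)^j} p/q`, `j ≤ 8`
  (`ζ(3)`, `ζ(5)`, `ζ(7)`, `π^k`, multiple zeta values of weight `≤ 8`, `Li_k` at rationals, …) in
  favour of the four moves — nothing in the tree or in print proves that;
* `stub_boxRigidity_var2232_of_parent` / `_of_statement`: Summit ⇒ parent ⇒ V2232, so a refutation of
  the variant would refute Conjecture 1 for the tree's calculus.
Source: M. Kontsevich, D. Zagier, *Periods* (2001), §1.2 Conjecture 1. Pure proof file, no definitions. -/

-- `Summit.<Summit>.<Problem>` is the tree's mandated summit-side namespace (CONVENTIONS §2); for this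
-- single-conjunct summit the two coincide, so the duplicate is deliberate.
set_option linter.dupNamespace false

noncomputable section

namespace Summit.KontsevichZagierPeriods.KontsevichZagierPeriods.Theorems

open MeasureTheory Set
open Literature.NumberTheory.Transcendental Literature.NumberTheory.Transcendental.KZ
open Summit.KontsevichZagierPeriods.KontsevichZagierPeriods.Theses.HurwitzMicroSectors
open Summit.KontsevichZagierPeriods.HurwitzMicroSectors.NormalFormPrinciple.PiBox

/-! ## The variant V2232: Conjecture 1 for box-rational periods of dimension `8` -/

/-- **V2232 ⟺ BoxVanishing in dimension `8`** (every box-rational representation on `(0,1)⁸` of value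
`0` is a relation): (⇒) the pair of dimensions `(2, 8)` is the variant's, so compare a vanishing
box-rational representation on `(0,1)⁸` with the zero representation on the square
(`boxVanishingDim_right_of_pair`); (⇐) pad both representations to the `8`-box and subtract there
(`boxRigidityLe_of_boxVanishingDim 8` with `m = 2 ≤ 8`, `m' = 8`). [cite: KontsevichZagier2001, §1.2 Conjecture 1] -/
theorem stub_boxRigidity_var2232_iff_boxVanishing_eight :
    (∀ (N : IntegralRep 2) (N' : IntegralRep 8), N.domain = {x | ∀ i, x i ∈ Set.Ioo (0:ℝ) 1} → N.IsRational → N'.domain = {x | ∀ i, x i ∈ Set.Ioo (0:ℝ) 1} → N'.IsRational → N.value = N'.value → Equivalent N N') ↔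
    (∀ (M : IntegralRep 8), M.domain = {x | ∀ i, x i ∈ Set.Ioo (0:ℝ) 1} → M.IsRational →
      M.value = 0 → of M ∈ relations) :=
  ⟨fun h => boxVanishingDim_right_of_pair 2 8 h,
    fun hvan N N' => boxRigidityLe_of_boxVanishingDim 8 hvan 2 8 N N' (by norm_num) le_rfl⟩

/-- **V2232 ⟺ BoxRigidity for all dimensions `m, m' ≤ 8`** (so V2232 coincides with every two-sided
sibling of maximum dimension `8`: `bound_nat:m≤8; bound_nat:m'≤8`, `fix_nat:m=8; bound_nat:m'≤k`, …).
[cite: KontsevichZagier2001, §1.2 Conjecture 1] -/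
theorem stub_boxRigidity_var2232_iff_le_eight :
    (∀ (N : IntegralRep 2) (N' : IntegralRep 8), N.domain = {x | ∀ i, x i ∈ Set.Ioo (0:ℝ) 1} → N.IsRational → N'.domain = {x | ∀ i, x i ∈ Set.Ioo (0:ℝ) 1} → N'.IsRational → N.value = N'.value → Equivalent N N') ↔
    (∀ (m m' : ℕ) (N : IntegralRep m) (N' : IntegralRep m'), m ≤ 8 → m' ≤ 8 →
      N.domain = {x | ∀ i, x i ∈ Set.Ioo (0:ℝ) 1} → N.IsRational →
      N'.domain = {x | ∀ i, x i ∈ Set.Ioo (0:ℝ) 1} → N'.IsRational →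
      N.value = N'.value → Equivalent N N') := by
  rw [stub_boxRigidity_var2232_iff_boxVanishing_eight]
  exact ⟨fun hvan => boxRigidityLe_of_boxVanishingDim 8 hvan,
    fun h => boxVanishingDim_left_of_pair 8 8 fun N N' => h 8 8 N N' le_rfl le_rfl⟩

/-- **V2232 ⇒ BoxVanishing in every dimension `j ≤ 8`** (monotonicity in the dimension, by padding):
in particular the dimension-`3` statement (`ζ(3)`, `π³`, `Li₃` values, …) and the dimension-`2` one.
[cite: KontsevichZagier2001, §1.2 Conjecture 1] -/
theorem boxVanishing_le_eight_of_stub_boxRigidity_var2232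
    (h : ∀ (N : IntegralRep 2) (N' : IntegralRep 8), N.domain = {x | ∀ i, x i ∈ Set.Ioo (0:ℝ) 1} → N.IsRational → N'.domain = {x | ∀ i, x i ∈ Set.Ioo (0:ℝ) 1} → N'.IsRational → N.value = N'.value → Equivalent N N')
    {j : ℕ} (hj : j ≤ 8) (N : IntegralRep j) (hNd : N.domain = {x | ∀ i, x i ∈ Set.Ioo (0:ℝ) 1})
    (hNr : N.IsRational) (hv : N.value = 0) : of N ∈ relations :=
  boxVanishingDim_mono hj (stub_boxRigidity_var2232_iff_boxVanishing_eight.1 h) N hNd hNr hv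

/-- **The parent leaf ⇒ V2232** (the variant is a specialisation of `stub_boxRigidity`; the converse is
not claimed — the parent is BoxVanishing in ALL dimensions). [cite: KontsevichZagier2001, §1.2 Conjecture 1] -/
theorem stub_boxRigidity_var2232_of_parent
    (h : ∀ (m m' : ℕ) (N : IntegralRep m) (N' : IntegralRep m'), N.domain = {x | ∀ i, x i ∈ Set.Ioo (0:ℝ) 1} → N.IsRational → N'.domain = {x | ∀ i, x i ∈ Set.Ioo (0:ℝ) 1} → N'.IsRational → N.value = N'.value → Equivalent N N') :
    ∀ (N : IntegralRep 2) (N' : IntegralRep 8), N.domain = {x | ∀ i, x i ∈ Set.Ioo (0:ℝ) 1} → N.IsRational → N'.domain = {x | ∀ i, x i ∈ Set.Ioo (0:ℝ) 1} → N'.IsRational → N.value = N'.value → Equivalent N N' :=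
  fun N N' => h 2 8 N N'

/-- **`KontsevichZagierPeriods ⇒ V2232`**: the variant is a special case of Conjecture 1 for the
tree's calculus (`leaves_of_statement`) — so a refutation of the variant would refute the Summit.
[cite: KontsevichZagier2001, §1.2 Conjecture 1] -/
theorem stub_boxRigidity_var2232_of_statement (h : _root_.KontsevichZagierPeriods) :
    ∀ (N : IntegralRep 2) (N' : IntegralRep 8), N.domain = {x | ∀ i, x i ∈ Set.Ioo (0:ℝ) 1} → N.IsRational → N'.domain = {x | ∀ i, x i ∈ Set.Ioo (0:ℝ) 1} → N'.IsRational → N.value = N'.value → Equivalent N N' :=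
  stub_boxRigidity_var2232_of_parent (leaves_of_statement h).1

end Summit.KontsevichZagierPeriods.KontsevichZagierPeriods.Theorems

end
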